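/-
Origin: expansion seat `planner-pub-hodgecm-pv11-g5-0`, handover #3 2026-08-18T08:01:55Z (`HOME/pub-hodgecm-pv11-g5/lean/Pv11g5/UnitaryLineChars.lean`, md5 925c64f5, 388 lines);
landed by the gen-7 packager in gate run 26 as `HodgeCM/PerL34/UnitaryLineChars.lean` (import ^import Pv[0-9]+g[0-9]+\.→import HodgeCM.PerL34. ×1).
-/
/-
Origin: expansion seat `planner-pub-hodgecm-pv11-g5-0` (unit `pub-hodgecm-pv11-g5`, DAG-NODE PROVER #11 gen 5), HodgeCM publication
cell, 2026-08-18.  WIP module `Pv11g5.UnitaryLineChars`; intended landing `HodgeCM/PerL34/UnitaryLineChars.lean`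
(one import rewrite: `Pv11g5.SeesawTorus` ↦ `HodgeCM.PerL34.SeesawTorus`).
NEW, ADDITIVE LEAF; imports the node-1 file `SeesawTorus` (run 26) and the landed tree modules `HodgeCM.PerL34.CharExt`
(pv05, run 19: the divisible-target extension ENGINE `N30_engine'`) and `HodgeCM.PerL34.UnitsNonarchimedean` (pv10, run 20:
`NonarchimedeanGroup (∏_v 𝒪_v)ˣ`).  Standard axioms only; no new constants.
-/
import Summits.HodgeConjecture.HodgeCM.PerL34.SeesawTorus_3
import Summits.HodgeConjecture.HodgeCM.PerL34.CharExt
import Summits.HodgeConjecture.HodgeCM.PerL34.UnitsNonarchimedean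

/-!
# Automorphic characters of `[U(1)]` with prescribed archimedean type — PerL Lemma 4.2(a) in the idelic model

PerL (`PerL-v5-FULL-d912a121.tex`), Lemma 4.2 `lem:chars`, ll. 528–529 (verbatim; l. 529 continues with part (b)):

> \textup{(a)} For every $e=(e_b)_b\in\Z^{\{b\}}$ there is an automorphic character $\chi'$ of $[\U(1)]=\U(1)(L_0)\backslash\A^1_L$
> with $\chi'_b(u)=u^{e_b}$ at every real place.

and its proof, ll. 537–542 (verbatim):

> (a) $\U(1)(L_0)=\{x\in L^\times:x\bar x=1\}$; its intersection with $\U(1)(L_0\otimes\R)\times K'$ for a compact open $K'\subset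
> \A^1_{L,f}$ contained in the unit ideles consists of elements of $\mathcal O_L^\times$ all of whose conjugates have absolute value
> $1$, i.e.\ of roots of unity (Kronecker), and is trivial once $K'$ is small; so the character $(u_\infty,k)\mapsto\prod_bu_b^{e_b}$
> of $\U(1)(L_0\otimes\R)\times K'$ descends to the open subgroup $\U(1)(L_0)\cdot(\U(1)(L_0\otimes\R)\times K')$ of $\A^1_L$ (trivial
> on $\U(1)(L_0)$), which has finite index ($[\U(1)]$ is compact), and extends to a character of $\A^1_L$ trivial on $\U(1)(L_0)$
> by divisibility of the circle group.

This file proves (a) as the kernel theorem `NumberField.exists_pontryaginDual_hasArchType` for the GENUINE automorphic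
quotient `[U(1)] = relNormOneIdeles L⁺ L ⧸ relNormOneRat L⁺ L` of `NormOneRelTorus` (pv11-g4, D3 dictionary) and the
archimedean-type predicate `NumberField.SeesawTorus.HasArchType` of `SeesawTorus` (node 1; the "real places `b` of `L₀`" ↔ "infinite
places `w` of the CM field `L`" dictionary is `NormOneRelTorusWeights`/`NormOneRelTorusCircles`: at a complex place `w`
the component `u_w ∈ U(1) ⊂ ℂ` is `archPlaceChars L u w`, and `χ'_b(u) = u^{e_b}` reads `archWeight L e`).

## Route of the proof (PerL's route; the Kronecker step replaced by a softer argument with the same conclusion)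

* §1 `ideleInfPart : 𝔸_L^× →* L_∞^×`, the archimedean component, is `Aut(L/K)`-equivariant, hence maps
  `U(1)(𝔸_K) = ker N_{L/K}` onto the archimedean torus `relNormOneInfUnits K L = ker N_∞`:
  `relNormOneInfPart K L : relNormOneIdeles K L →* relNormOneInfUnits K L`, a continuous retraction of pv11-g4's
  `relNormOneInfToIdeles K L` (`y ↦ (y,1)`).
* §2 (ll. 537–539: the intersection of `U(1)(L_0)` with `U(1)(L_0 ⊗ ℝ) × K'` "is trivial once $K'$ is small"):
  `exists_level_forall_mem_relNormOneRat_eq_one`.  PerL argues through Kronecker's theorem (the intersection "consists of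
  elements of $\mathcal O_L^\times$ all of whose conjugates have absolute value $1$, i.e.\ of roots of unity"); we prove the
  SAME conclusion directly from two facts already in the tree: `relNormOneRat K L` is a DISCRETE closed subgroup (pv11-g4
  `discreteTopology_relNormOneRat`, from the discreteness of `L^× ⊂ 𝔸_L^×`) and the archimedean torus is COMPACT (pv11-g4
  `compactSpace_unitaryLineArchTorus`).  A rational point with trivial finite component is `1` (PerL l. 388: "a rational
  point with trivial finite component is $1$"; here `relNormOneInfToIdeles_mem_relNormOneRat_iff`), so the compact set
  `U(1)(L_0 ⊗ ℝ) × {1}` misses the closed set `U(1)(L_0) ∖ {1}`; the tube lemma (`compact_open_separated_mul_right`) gives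
  an identity neighbourhood `V` with `(U(1)(L_0⊗ℝ)×{1}) · V` still missing it, and `V` contains `{1} × K'` for an open
  subgroup `K' ≤ (∏_v 𝒪_v)ˣ` (pv10: the integral ideles form a nonarchimedean group, `UnitsNonarchimedean`; the product
  `L_∞^× · K'` is open in `𝔸_L^×` by pv10's `isOpenMap_infUnits_mul_intUnits_idele`).
* §3 (ll. 539–542: the character "descends to the open subgroup $\U(1)(L_0)\cdot(\U(1)(L_0\otimes\R)\times K')$ of $\A^1_L$
  (trivial on $\U(1)(L_0)$) … and extends to a character of $\A^1_L$ trivial on $\U(1)(L_0)$ by divisibility of the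
  circle group"): the weight character `u ↦ ∏_w u_w^{e_w}` of `U(1)(𝔸) ∩ (L_∞^× · K')` (`levelWeightChar`) is continuous
  and kills the rational points of that open subgroup, so pv05's engine `HodgeCM.PerL34.CharExt.N30_engine'` (descent to
  `U(1)(L_0) · H`, extension by divisibility of `S¹`, automatic continuity from the open subgroup `H`) produces a
  continuous character of `U(1)(𝔸)` trivial on `U(1)(L_0)` with the right restriction; it descends to the quotient
  `[U(1)]` (`QuotientGroup.lift`, continuity by `QuotientGroup.isOpenQuotientMap_mk`), and `SeesawTorus.hasArchType_iff`
  (node 1) reads off the archimedean type.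

PerL and the 2001-programme texts are the objects under adjudication, quoted for STATEMENTS only; every step above is
kernel-proved here from Mathlib and landed tree modules.
-/

set_option autoImplicit false

noncomputable section

open Topology Set Function Filter
open scoped Pointwise

namespace NumberField

open IsDedekindDomain
open Literature.NumberTheory Literature.NumberTheory.Automorphic

/-! ## §1 The archimedean component of an idele and of a norm-one idele -/

section InfPart

variable (L : Type) [Field L] [NumberField L]

/-- The archimedean component `u ↦ u_∞ : 𝔸_L^× →* L_∞^×`. -/
def ideleInfPart : ideleGroup L →* (InfiniteAdeleRing L)ˣ :=
  (MonoidHom.fst _ _).comp (ideleGroupSplitMulEquiv L).toMonoidHom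

/-- (Ported verbatim from the HodgeCMPerL package; no docstring in the source.) -/
theorem ideleInfPart_apply (u : ideleGroup L) : ideleInfPart L u = (ideleGroupSplitMulEquiv L u).1 := rfl

/-- (Ported verbatim from the HodgeCMPerL package; no docstring in the source.) -/
@[simp] theorem coe_ideleInfPart (u : ideleGroup L) :
    ((ideleInfPart L u : (InfiniteAdeleRing L)ˣ) : InfiniteAdeleRing L) = (u : AdeleRing (𝓞 L) L).1 := rfl

/-- (Ported verbatim from the HodgeCMPerL package; no docstring in the source.) -/
theorem continuous_ideleInfPart : Continuous (ideleInfPart L) := by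
  change Continuous fun u => (ideleGroupSplit L u).1
  exact (ideleGroupSplit L).continuous.fst

/-- `(y, 1)_∞ = y`. -/
@[simp] theorem ideleInfPart_infUnitsToIdele (y : (InfiniteAdeleRing L)ˣ) :
    ideleInfPart L (infUnitsToIdele L y) = y := by
  change ((ideleGroupSplitMulEquiv L) ((ideleGroupSplitMulEquiv L).symm (y, 1))).1 = y
  rw [MulEquiv.apply_symm_apply]

/-- `(1, k)_∞ = 1`. -/
@[simp] theorem ideleInfPart_intUnitsToIdele (k : (integralAdeles L)ˣ) :
    ideleInfPart L (intUnitsToIdele L k) = 1 := by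
  change ((ideleGroupSplitMulEquiv L) ((ideleGroupSplitMulEquiv L).symm
    (1, Units.map (structureRingHom L : integralAdeles L →* FiniteAdeleRing (𝓞 L) L) k))).1 = 1
  rw [MulEquiv.apply_symm_apply]

variable (K : Type) [Field K] [Algebra K L]

/-- The archimedean component is `Aut(L/K)`-equivariant. -/
theorem ideleInfPart_smul (σ : L ≃ₐ[K] L) (u : ideleGroup L) :
    ideleInfPart L (σ • u) = σ • ideleInfPart L u := by
  apply Units.ext
  rw [coe_ideleInfPart, InfiniteAdeleRing.coe_smul_units, coe_ideleInfPart, AdeleRing.coe_smul_units,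
    AdeleRing.smul_fst]

variable [FiniteDimensional K L]

/-- `(N_{L/K} u)_∞ = N_∞ (u_∞)`: the archimedean component intertwines the idelic and the archimedean Galois norms. -/
theorem ideleInfPart_ideleGalNorm (u : ideleGroup L) :
    ideleInfPart L (AdeleRing.ideleGalNorm K L u) = infGalNorm K L (ideleInfPart L u) := by
  rw [AdeleRing.ideleGalNorm_apply, infGalNorm_apply, map_prod]
  exact Finset.prod_congr rfl fun σ _ => ideleInfPart_smul L K σ u

/-- The archimedean component of a norm-one idele lies in the archimedean torus `U(1)_{L/K}(K ⊗ ℝ)`. -/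
theorem ideleInfPart_mem_relNormOneInfUnits {u : ideleGroup L} (hu : u ∈ relNormOneIdeles K L) :
    ideleInfPart L u ∈ relNormOneInfUnits K L := by
  rw [mem_relNormOneInfUnits_iff, ← ideleInfPart_ideleGalNorm, (mem_relNormOneIdeles_iff K L u).mp hu, map_one]

/-- **`u ↦ u_∞ : U(1)(𝔸_K) →* U(1)(K ⊗ ℝ)`**, the archimedean component of the relative norm-one torus. -/
def relNormOneInfPart : relNormOneIdeles K L →* relNormOneInfUnits K L :=
  ((ideleInfPart L).comp (relNormOneIdeles K L).subtype).codRestrict (relNormOneInfUnits K L)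
    fun u => ideleInfPart_mem_relNormOneInfUnits L K u.2

/-- (Ported verbatim from the HodgeCMPerL package; no docstring in the source.) -/
@[simp] theorem coe_relNormOneInfPart (u : relNormOneIdeles K L) :
    ((relNormOneInfPart L K u : relNormOneInfUnits K L) : (InfiniteAdeleRing L)ˣ) = ideleInfPart L u := rfl

/-- (Ported verbatim from the HodgeCMPerL package; no docstring in the source.) -/
theorem continuous_relNormOneInfPart : Continuous (relNormOneInfPart L K) :=
  ((continuous_ideleInfPart L).comp continuous_subtype_val).subtype_mk _

/-- `relNormOneInfPart` is a retraction of the archimedean embedding `y ↦ (y, 1)` of pv11-g4. -/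
@[simp] theorem relNormOneInfPart_relNormOneInfToIdeles (y : relNormOneInfUnits K L) :
    relNormOneInfPart L K (relNormOneInfToIdeles K L y) = y :=
  Subtype.ext (by rw [coe_relNormOneInfPart, coe_relNormOneInfToIdeles, ideleInfPart_infUnitsToIdele])

/-- PerL l. 388: "a rational point with trivial finite component is `1`" — an archimedean torus element `(y, 1)` is a
principal idele only if `y = 1`. -/
theorem relNormOneInfToIdeles_mem_relNormOneRat_iff (y : relNormOneInfUnits K L) :
    relNormOneInfToIdeles K L y ∈ relNormOneRat K L ↔ y = 1 := by
  constructor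
  · intro hy
    rw [mem_relNormOneRat_iff, coe_relNormOneInfToIdeles] at hy
    obtain ⟨x, hx⟩ := MonoidHom.mem_range.mp hy
    -- compare finite components: `(x)_f = 1` in `𝔸_{L,f}`, hence at one finite place, hence `x = 1`
    have h2 : (algebraMap L (AdeleRing (𝓞 L) L) (x : L)).2 = (algebraMap L (AdeleRing (𝓞 L) L) 1).2 := by
      have h := congrArg (fun u : ideleGroup L => ((u : AdeleRing (𝓞 L) L)).2) hx
      simp only [Units.coe_map, MonoidHom.coe_coe, coe_infUnitsToIdele] at h
      rw [h, map_one]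
      rfl
    obtain ⟨I, hI⟩ := Ideal.exists_maximal (𝓞 L)
    let v : HeightOneSpectrum (𝓞 L) :=
      ⟨I, hI.isPrime, Ring.ne_bot_of_isMaximal_of_not_isField hI (RingOfIntegers.not_isField L)⟩
    have hv := congrFun (congrArg (fun z : FiniteAdeleRing (𝓞 L) L => (z : ∀ w : HeightOneSpectrum (𝓞 L), _)) h2) v
    simp only [AdeleRing.algebraMap_snd_apply] at hv
    have hx1 : (x : L) = 1 := (algebraMap L (v.adicCompletion L)).injective hv
    have hx1' : x = 1 := Units.ext hx1
    rw [hx1', map_one] at hx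
    -- `(y, 1) = 1` forces `y = 1`
    have hy1 : (y : (InfiniteAdeleRing L)ˣ) = 1 :=
      infUnitsToIdele_injective (L := L) (by rw [map_one]; exact hx.symm)
    exact Subtype.ext hy1
  · rintro rfl
    rw [map_one]
    exact one_mem _

end InfPart

/-! ## §2 `U(1)(L_0) ∩ (U(1)(L_0 ⊗ ℝ) × K')` "is trivial once $K'$ is small" (PerL ll. 537–539) -/

section Level

variable (L : Type) [Field L] [NumberField L]

/-- `(x, k) ↦ (x, 1)·(1, k) : L_∞^× × (∏_v 𝒪_v)ˣ →* 𝔸_L^×` (pv10's open embedding, as a homomorphism). -/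
def infIntUnitsToIdele : (InfiniteAdeleRing L)ˣ × (integralAdeles L)ˣ →* ideleGroup L :=
  (infUnitsToIdele L).coprod (intUnitsToIdele L)

/-- (Ported verbatim from the HodgeCMPerL package; no docstring in the source.) -/
theorem infIntUnitsToIdele_apply (p : (InfiniteAdeleRing L)ˣ × (integralAdeles L)ˣ) :
    infIntUnitsToIdele L p = infUnitsToIdele L p.1 * intUnitsToIdele L p.2 := rfl

/-- (Ported verbatim from the HodgeCMPerL package; no docstring in the source.) -/
theorem isOpenMap_infIntUnitsToIdele : IsOpenMap (infIntUnitsToIdele L) :=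
  isOpenMap_infUnits_mul_intUnits_idele L

/-- **`L_∞^× · K' ≤ 𝔸_L^×`** for a subgroup `K' ≤ (∏_v 𝒪_v)ˣ` of the integral ideles. -/
def infLevelSubgroup (K' : Subgroup (integralAdeles L)ˣ) : Subgroup (ideleGroup L) :=
  ((⊤ : Subgroup (InfiniteAdeleRing L)ˣ).prod K').map (infIntUnitsToIdele L)

/-- (Ported verbatim from the HodgeCMPerL package; no docstring in the source.) -/
theorem mem_infLevelSubgroup_iff (K' : Subgroup (integralAdeles L)ˣ) (u : ideleGroup L) :
    u ∈ infLevelSubgroup L K' ↔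
      ∃ (x : (InfiniteAdeleRing L)ˣ) (k : (integralAdeles L)ˣ), k ∈ K' ∧ u = infUnitsToIdele L x * intUnitsToIdele L k := by
  constructor
  · rintro ⟨p, hp, rfl⟩
    exact ⟨p.1, p.2, (Subgroup.mem_prod.mp hp).2, rfl⟩
  · rintro ⟨x, k, hk, rfl⟩
    exact ⟨(x, k), Subgroup.mem_prod.mpr ⟨Subgroup.mem_top x, hk⟩, rfl⟩

/-- (Ported verbatim from the HodgeCMPerL package; no docstring in the source.) -/
theorem infUnitsToIdele_mem_infLevelSubgroup (K' : Subgroup (integralAdeles L)ˣ) (x : (InfiniteAdeleRing L)ˣ) :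
    infUnitsToIdele L x ∈ infLevelSubgroup L K' :=
  (mem_infLevelSubgroup_iff L K' _).mpr ⟨x, 1, one_mem K', by rw [map_one, mul_one]⟩

/-- `L_∞^× · K'` is open in `𝔸_L^×` when `K'` is open in `(∏_v 𝒪_v)ˣ`. -/
theorem isOpen_infLevelSubgroup (K' : OpenSubgroup (integralAdeles L)ˣ) :
    IsOpen (infLevelSubgroup L (K' : Subgroup (integralAdeles L)ˣ) : Set (ideleGroup L)) := by
  rw [infLevelSubgroup, Subgroup.coe_map, Subgroup.coe_prod]
  exact isOpenMap_infIntUnitsToIdele L _ (isOpen_univ.prod K'.isOpen)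

variable (K : Type) [Field K] [Algebra K L] [FiniteDimensional K L]

/-- **`U(1)(𝔸_K) ∩ (L_∞^× · K') = U(1)(K ⊗ ℝ) · (U(1)(𝔸_{K,f}) ∩ K')`**, the level-`K'` open subgroup of the norm-one
torus (the norm-one part of PerL's `U(1)(L_0 ⊗ ℝ) × K'`, ll. 537–540). -/
def relNormOneLevel (K' : Subgroup (integralAdeles L)ˣ) : Subgroup (relNormOneIdeles K L) :=
  (infLevelSubgroup L K').comap (relNormOneIdeles K L).subtype

/-- (Ported verbatim from the HodgeCMPerL package; no docstring in the source.) -/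
theorem mem_relNormOneLevel_iff (K' : Subgroup (integralAdeles L)ˣ) (u : relNormOneIdeles K L) :
    u ∈ relNormOneLevel L K K' ↔ (u : ideleGroup L) ∈ infLevelSubgroup L K' := Iff.rfl

/-- (Ported verbatim from the HodgeCMPerL package; no docstring in the source.) -/
theorem isOpen_relNormOneLevel (K' : OpenSubgroup (integralAdeles L)ˣ) :
    IsOpen (relNormOneLevel L K (K' : Subgroup (integralAdeles L)ˣ) : Set (relNormOneIdeles K L)) := by
  rw [relNormOneLevel, Subgroup.coe_comap]
  exact (isOpen_infLevelSubgroup L K').preimage continuous_subtype_val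

/-- (Ported verbatim from the HodgeCMPerL package; no docstring in the source.) -/
theorem relNormOneInfToIdeles_mem_relNormOneLevel (K' : Subgroup (integralAdeles L)ˣ) (y : relNormOneInfUnits K L) :
    relNormOneInfToIdeles K L y ∈ relNormOneLevel L K K' :=
  infUnitsToIdele_mem_infLevelSubgroup L K' _

/-- Decomposition of a level-`K'` norm-one idele: `u = (u_∞, 1) · (1, k)` with `u_∞` in the archimedean torus and
`k ∈ K'`. -/
theorem exists_eq_mul_of_mem_relNormOneLevel {K' : Subgroup (integralAdeles L)ˣ} {u : relNormOneIdeles K L}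
    (hu : u ∈ relNormOneLevel L K K') :
    ∃ k : (integralAdeles L)ˣ, k ∈ K' ∧
      (u : ideleGroup L) = infUnitsToIdele L (relNormOneInfPart L K u : (InfiniteAdeleRing L)ˣ) * intUnitsToIdele L k := by
  obtain ⟨x, k, hk, hxk⟩ := (mem_infLevelSubgroup_iff L K' (u : ideleGroup L)).mp ((mem_relNormOneLevel_iff L K K' u).mp hu)
  refine ⟨k, hk, ?_⟩
  have hx : (relNormOneInfPart L K u : (InfiniteAdeleRing L)ˣ) = x := by
    rw [coe_relNormOneInfPart, hxk, map_mul, ideleInfPart_infUnitsToIdele, ideleInfPart_intUnitsToIdele, mul_one]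
  rw [hx]
  exact hxk

/-- **PerL ll. 537–539 — `U(1)(L_0) ∩ (U(1)(L_0 ⊗ ℝ) × K') = 1` once `K'` is small.**  For a relative torus whose
archimedean part is compact there is an open subgroup `K'` of the integral ideles such that the only rational point of
the level-`K'` open subgroup `U(1)(𝔸_K) ∩ (L_∞^× · K')` is `1`.  (Discreteness of `U(1)(K)` + compactness of
`U(1)(K ⊗ ℝ)` + the tube lemma; PerL's Kronecker argument is not needed.) -/
theorem exists_level_forall_mem_relNormOneRat_eq_one [CompactSpace (relNormOneInfUnits K L)] :
    ∃ K' : OpenSubgroup (integralAdeles L)ˣ,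
      ∀ u : relNormOneIdeles K L, u ∈ relNormOneLevel L K (K' : Subgroup (integralAdeles L)ˣ) →
        u ∈ relNormOneRat K L → u = 1 := by
  classical
  -- the compact set `C = U(1)(K ⊗ ℝ) × {1}`
  have hC : IsCompact (Set.range (relNormOneInfToIdeles K L)) :=
    isCompact_range (continuous_relNormOneInfToIdeles K L)
  -- the closed set `Γ' = U(1)(K) ∖ {1}` (a subset of a discrete closed subgroup)
  have hΓ' : IsClosed ((relNormOneRat K L : Set (relNormOneIdeles K L)) \ {1}) := by
    have hce : IsClosedEmbedding (Subtype.val : relNormOneRat K L → relNormOneIdeles K L) :=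
      (isClosed_relNormOneRat K L).isClosedEmbedding_subtypeVal
    have heq : (relNormOneRat K L : Set (relNormOneIdeles K L)) \ {1} =
        Subtype.val '' {γ : relNormOneRat K L | γ ≠ 1} := by
      ext a
      constructor
      · rintro ⟨ha, hne⟩
        exact ⟨⟨a, ha⟩, fun h => hne (congrArg Subtype.val h), rfl⟩
      · rintro ⟨γ, hγ, rfl⟩
        exact ⟨γ.2, fun h => hγ (Subtype.ext h)⟩
    rw [heq]
    exact hce.isClosedMap _ (isClosed_discrete _)
  -- `C` misses `Γ'`
  have hCΓ : Set.range (relNormOneInfToIdeles K L) ⊆ ((relNormOneRat K L : Set (relNormOneIdeles K L)) \ {1})ᶜ := by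
    rintro _ ⟨y, rfl⟩ ⟨hmem, hne⟩
    exact hne (by
      rw [Set.mem_singleton_iff, (relNormOneInfToIdeles_mem_relNormOneRat_iff L K y).mp hmem, map_one])
  -- tube lemma: an identity neighbourhood `V` with `C · V` still missing `Γ'`
  obtain ⟨V, hV, hCV⟩ := compact_open_separated_mul_right hC hΓ'.isOpen_compl hCΓ
  -- `V ⊇ U(1)(𝔸) ∩ W` for an identity neighbourhood `W` of the ideles
  obtain ⟨W, hW, hWV⟩ : ∃ W ∈ 𝓝 (1 : ideleGroup L), Subtype.val ⁻¹' W ⊆ V :=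
    (mem_nhds_subtype _ _ _).mp hV
  -- `W ⊇ {1} × K'` for an open subgroup `K'` of the (nonarchimedean) integral ideles
  have hW1 : intUnitsToIdele L ⁻¹' W ∈ 𝓝 (1 : (integralAdeles L)ˣ) :=
    (continuous_intUnitsToIdele L).continuousAt.preimage_mem_nhds (by rwa [map_one])
  obtain ⟨K', hK'W⟩ := NonarchimedeanGroup.is_nonarchimedean _ hW1
  refine ⟨K', fun u hu hΓu => ?_⟩
  -- `u = c · v` with `c ∈ C`, `v = (1, k) ∈ V`
  obtain ⟨k, hk, huk⟩ := exists_eq_mul_of_mem_relNormOneLevel L K hu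
  set c : relNormOneIdeles K L := relNormOneInfToIdeles K L (relNormOneInfPart L K u) with hc
  have hv : c⁻¹ * u ∈ V := by
    apply hWV
    show ((c⁻¹ * u : relNormOneIdeles K L) : ideleGroup L) ∈ W
    rw [Subgroup.coe_mul, Subgroup.coe_inv, hc, coe_relNormOneInfToIdeles, huk, inv_mul_cancel_left]
    exact hK'W hk
  have hu' : u ∈ Set.range (relNormOneInfToIdeles K L) * V :=
    Set.mem_mul.mpr ⟨c, ⟨_, rfl⟩, c⁻¹ * u, hv, mul_inv_cancel_left c u⟩
  by_contra hne
  exact hCV hu' ⟨hΓu, hne⟩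

end Level

/-! ## §3 PerL Lemma 4.2(a): characters of `[U(1)]` of every archimedean type -/

section CM

variable (L : Type) [Field L] [NumberField L] [IsCMField L]

local notation "L⁺" => maximalRealSubfield L

/-- The weight-`e` character `u ↦ ∏_w (u_∞)_w^{e_w}` of the level-`K'` subgroup `U(1)(𝔸) ∩ (L_∞^× · K')`
(PerL ll. 539–540: "the character $(u_\infty,k)\mapsto\prod_bu_b^{e_b}$ of $\U(1)(L_0\otimes\R)\times K'$"). -/
def levelWeightChar (e : InfinitePlace L → ℤ) (K' : Subgroup (integralAdeles L)ˣ) :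
    relNormOneLevel L L⁺ K' →* Circle :=
  (archWeightCircle L e).comp ((relNormOneInfPart L L⁺).comp (relNormOneLevel L L⁺ K').subtype)

/-- (Ported verbatim from the HodgeCMPerL package; no docstring in the source.) -/
theorem levelWeightChar_apply (e : InfinitePlace L → ℤ) (K' : Subgroup (integralAdeles L)ˣ)
    (u : relNormOneLevel L L⁺ K') :
    levelWeightChar L e K' u = archWeightCircle L e (relNormOneInfPart L L⁺ (u : relNormOneIdeles L⁺ L)) := rfl

/-- (Ported verbatim from the HodgeCMPerL package; no docstring in the source.) -/
theorem continuous_levelWeightChar (e : InfinitePlace L → ℤ) (K' : Subgroup (integralAdeles L)ˣ) :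
    Continuous (levelWeightChar L e K') :=
  (continuous_archWeightCircle L e).comp ((continuous_relNormOneInfPart L L⁺).comp continuous_subtype_val)

/-- On the archimedean torus the level character IS the weight character. -/
theorem levelWeightChar_relNormOneInfToIdeles (e : InfinitePlace L → ℤ) (K' : Subgroup (integralAdeles L)ˣ)
    (t : unitaryLineArchTorus L) :
    levelWeightChar L e K' ⟨relNormOneInfToIdeles L⁺ L t, relNormOneInfToIdeles_mem_relNormOneLevel L L⁺ K' t⟩ =
      archWeightCircle L e t := by
  rw [levelWeightChar_apply]
  exact congrArg (archWeightCircle L e) (relNormOneInfPart_relNormOneInfToIdeles L L⁺ t)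

/-- **A continuous character of `U(1)(𝔸_{L⁺})`, trivial on `U(1)(L⁺)`, restricting to the weight-`e` character on the
archimedean torus** (PerL ll. 539–542: "extends to a character of $\A^1_L$ trivial on $\U(1)(L_0)$ by divisibility of
the circle group" — before passing to the quotient). -/
theorem exists_continuousMonoidHom_relNormOneIdeles_archWeight (e : InfinitePlace L → ℤ) :
    ∃ χ : ContinuousMonoidHom (relNormOneIdeles L⁺ L) Circle,
      relNormOneRat L⁺ L ≤ (χ : relNormOneIdeles L⁺ L →* Circle).ker ∧
        ∀ t : unitaryLineArchTorus L, χ (relNormOneInfToIdeles L⁺ L t) = archWeightCircle L e t := by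
  haveI : CompactSpace (relNormOneInfUnits L⁺ L) := compactSpace_unitaryLineArchTorus L
  obtain ⟨K', hK'⟩ := exists_level_forall_mem_relNormOneRat_eq_one L L⁺
  have hψ : ∀ u : relNormOneLevel L L⁺ (K' : Subgroup (integralAdeles L)ˣ),
      (u : relNormOneIdeles L⁺ L) ∈ relNormOneRat L⁺ L → levelWeightChar L e K' u = 1 := by
    intro u hu
    have h1 : (u : relNormOneIdeles L⁺ L) = 1 := hK' u u.2 hu
    have h1' : u = 1 := Subtype.ext h1
    rw [h1', map_one]
  obtain ⟨χ, hker, hχ⟩ :=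
    HodgeCM.PerL34.CharExt.N30_engine' (relNormOneRat L⁺ L) (relNormOneLevel L L⁺ (K' : Subgroup (integralAdeles L)ˣ))
      (isOpen_relNormOneLevel L L⁺ K') (levelWeightChar L e K') (continuous_levelWeightChar L e K') hψ
  refine ⟨χ, hker, fun t => ?_⟩
  rw [← levelWeightChar_relNormOneInfToIdeles L e (K' : Subgroup (integralAdeles L)ˣ) t, ← hχ]

/-- **PerL Lemma 4.2(a) (`lem:chars`(a), ll. 528–529) in the idelic model.**  For every `e : {infinite places of L} → ℤ`
there is an automorphic character `χ` of `[U(1)] = U(1)(L⁺) \ U(1)(𝔸_{L⁺})` (the genuine compact quotient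
`relNormOneIdeles L⁺ L ⧸ relNormOneRat L⁺ L` of `NormOneRelTorus`) whose archimedean component is `u ↦ ∏_w u_w^{e_w}`,
i.e. `SeesawTorus.HasArchType L χ e` (node 1, `SeesawTorus.hasArchType_iff`). -/
theorem exists_pontryaginDual_hasArchType (e : InfinitePlace L → ℤ) :
    ∃ χ : PontryaginDual (relNormOneIdeles L⁺ L ⧸ relNormOneRat L⁺ L), SeesawTorus.HasArchType L χ e := by
  obtain ⟨χ, hker, hχ⟩ := exists_continuousMonoidHom_relNormOneIdeles_archWeight L e
  -- descend to the quotient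
  let χq : (relNormOneIdeles L⁺ L ⧸ relNormOneRat L⁺ L) →* Circle :=
    QuotientGroup.lift (relNormOneRat L⁺ L) (χ : relNormOneIdeles L⁺ L →* Circle) hker
  have hχq : ∀ u : relNormOneIdeles L⁺ L, χq (QuotientGroup.mk u) = χ u := fun u => rfl
  have hcomp : (χq : _ → Circle) ∘ (QuotientGroup.mk : relNormOneIdeles L⁺ L → _) = χ := funext hχq
  have hχq_cont : Continuous χq := by
    rw [← QuotientGroup.isOpenQuotientMap_mk.continuous_comp_iff, hcomp]
    exact χ.continuous
  refine ⟨{ toMonoidHom := χq, continuous_toFun := hχq_cont }, (SeesawTorus.hasArchType_iff _ e).mpr fun t => ?_⟩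
  rw [archWeight_apply, ← hχ t]
  rfl

/-- The set of archimedean types realised by automorphic characters of `[U(1)]` is ALL of `ℤ^{places}`
(restatement of `exists_pontryaginDual_hasArchType` as a surjectivity onto weights). -/
theorem forall_archType_exists_pontryaginDual :
    ∀ e : InfinitePlace L → ℤ,
      ∃ χ : PontryaginDual (relNormOneIdeles L⁺ L ⧸ relNormOneRat L⁺ L), SeesawTorus.HasArchType L χ e :=
  exists_pontryaginDual_hasArchType L

end CM

end NumberField

end
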